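import Mathlib
import HarnessLib
import Literature.Analysis.FluidPDE.NSLocalLerayBackwardUniqueness
import Summits.NavierStokesRegularity.NavierStokesRegularity.Theorems.PoloidalWindowDoorPoloidalWindowRigidityVorticityTranslate

/-!
# Door S11 `LocalTubeDoorHelicity` (nsreg-p1 ROUND-11/13), profile crux K2⁗ `FrobeniusProfileRigidity` —
# the SCREW-VORTICITY stratum is empty: stub 2 `stub_screwSliceRigidity` of the birth skeleton (screw / affine
# vorticity on a window of ONE slice)

Cell ns-regularity-ideate, seat p5 (route-directed support for the door route `route-helicity` staged by p1 g11;
lands `--supports` the K2⁗ item; no claim on the crux).  The birth skeleton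
`bc/FrobeniusProfileRigidity_birth.lean` of K2⁗ reduces the crux to two stubs: the OPEN slice quadrichotomy
(stub 1, the lead's) and **screw-slice rigidity** (stub 2, «provable, M»):

  `ScrewSliceRigidity := ∀ C v, FrobeniusClass C v → (∃ s < 0, HasScrewVorticityBall v s) →
    ¬ IsBackwardSingularPoint v 0`,

where `FrobeniusClass C v` is the door family's Type-I profile class (Type-I time rate, continuity on the open
slab, unit-viscosity Oseen-mild identity, divergence-free slices) plus identically vanishing helicity density, and
`HasScrewVorticityBall v s` says that on a nonempty open set of the slice `s` the vorticity IS an affine screw field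
`k • (d × (y − c) + h • d)` with `k ≠ 0`, `d ≠ 0`.

This file proves stub 2, in the following slightly stronger and reusable form (the helicity hypothesis is idle):

* `crossCLM_ne_zero` — `y ↦ d × y` is a nonzero linear map for `d ≠ 0`;
* `curl_slice_eq_affine_of_eqOn` — if the vorticity of a slice `s < 0` of a profile of the Type-I class agrees on
  a nonempty open set with an affine map `y ↦ L y + b`, it agrees with it on all of `ℝ³` (the slice vorticity is
  real-analytic: tree `analyticOnNhd_slice` + `analyticOnNhd_curl`; identity theorem on the connected `ℝ³`);
* `false_of_curl_slice_eqOn_affine` — … which is absurd when `L ≠ 0`: `‖L (n • w) + b‖ ≥ n ‖L w‖ − ‖b‖ → ∞`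
  along a direction `w` with `L w ≠ 0`, against the class's bounded slice vorticity (tree
  `exists_norm_curl_slice_le`, KNSS 2009 (4.10) after a time shift);
* `eq_zero_of_curl_slice_eqOn_affine` — … while for `L = 0` the slice vorticity is constant on `ℝ³`, hence
  translation-invariant, and the tree's stratum (A) `eq_zero_of_curl_translate_eq_slice` gives `v ≡ 0`: so an
  AFFINE vorticity on an open set of one slice forces `v ≡ 0`, whatever the linear part;
* `false_of_screwVorticityBall` / `eq_zero_of_screwVorticityBall` — the screw field is the affine map
  `L = k • crossCLM d`, `b = k • (h • d − d × c)` (`L ≠ 0` iff `k ≠ 0` and `d ≠ 0`; the `v ≡ 0` form needs neither);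
* `screwSliceRigidity` — **stub 2 with `FrobeniusClass` / `HasScrewVorticityBall` unfolded verbatim** (the lead
  closes the registered stub by `intro C v hcls hs; exact screwSliceRigidity hcls hs`).

The companion screw stratum on the SYMMETRY side (helically symmetric slices, pitch `≠ 0`) is the sibling file
`…FrobeniusProfileRigidityHelicalSlice`.

SUPPORT EDGE (route-NavierStokesRegularity-LocalHelicityTubeDoor born; director-ns g6 #1 (5)): this file is re-pointed
`--supports stmt-NavierStokesRegularity-19975 --as helper` (nsreg-p5 g7 p472222: stub 2 screwSliceRigidity); it was parked on the
CLOSED fallback anchor stmt-NavierStokesRegularity-20018 while the route was unborn.  Declarations unchanged.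

WHAT THIS IS NOT: not a claim about Navier–Stokes regularity and not K2⁗ (whose load-bearing stub 1 stays OPEN) — one
settled stratum of a door route's profile crux (bears_on LADDER-NS N0, door S11).
-/

noncomputable section

-- the summit and its single sub-problem share the name (CONVENTIONS §1), as in every Theorems file
set_option linter.dupNamespace false

namespace Summit.NavierStokesRegularity.NavierStokesRegularity.Theorems.LocalHelicityTubeDoorFrobeniusProfileRigidityScrewSlice

open MeasureTheory Set Function Filter Topology TopologicalSpace Metric
open scoped RealInnerProductSpace InnerProductSpace
open Literature.Analysis Literature.Analysis.FluidPDE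
open Summit.NavierStokesRegularity.NavierStokesRegularity.Theorems.LocalSineTubeDoorProfileAlignedWindowRigidityAncient
open Summit.NavierStokesRegularity.NavierStokesRegularity.Theorems.PoloidalWindowDoorPoloidalWindowRigidityFlat
open Summit.NavierStokesRegularity.NavierStokesRegularity.Theorems.PoloidalWindowDoorPoloidalWindowRigidityVorticityTranslate

variable {C : ℝ} {v : ℝ → EuclideanSpace ℝ (Fin 3) → EuclideanSpace ℝ (Fin 3)}

/-! ### The linear map `y ↦ d × y` is nonzero for `d ≠ 0` -/

/-- Coordinates of `d × e₀`, `e₀ = (1,0,0)`: `(0, d₂, −d₁)`. -/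
theorem cross_single_zero (d : EuclideanSpace ℝ (Fin 3)) :
    cross d (EuclideanSpace.single 0 1) 1 = d 2 ∧ cross d (EuclideanSpace.single 0 1) 2 = -d 1 := by
  constructor <;> simp [cross, crossProduct]

/-- Coordinates of `d × e₁`, `e₁ = (0,1,0)`: `(−d₂, 0, d₀)`. -/
theorem cross_single_one (d : EuclideanSpace ℝ (Fin 3)) :
    cross d (EuclideanSpace.single 1 1) 2 = d 0 := by
  simp [cross, crossProduct]

/-- **`crossCLM d ≠ 0` for `d ≠ 0`**: if `d × e₀ = 0` and `d × e₁ = 0` then `d₂ = d₁ = 0` and `d₀ = 0`. -/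
theorem crossCLM_ne_zero {d : EuclideanSpace ℝ (Fin 3)} (hd : d ≠ 0) : crossCLM d ≠ 0 := by
  intro h0
  apply hd
  have h₀ : cross d (EuclideanSpace.single 0 1) = 0 := by
    rw [← crossCLM_apply, h0, zero_apply]
  have h₁ : cross d (EuclideanSpace.single 1 1) = 0 := by
    rw [← crossCLM_apply, h0, zero_apply]
  obtain ⟨h2, h1⟩ := cross_single_zero d
  have h0' := cross_single_one d
  rw [h₀] at h2 h1
  rw [h₁] at h0'
  ext i
  fin_cases i
  · simpa using h0'.symm
  · have : d 1 = 0 := by simpa using h1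
    simpa using this
  · simpa using h2.symm

/-! ### Affine vorticity on an open set of ONE slice is impossible in the Type-I class -/

/-- **Identity theorem for the slice vorticity.** If the vorticity of the slice `s < 0` of a profile of the Type-I
class agrees on a nonempty open set `U` with an affine map `y ↦ L y + b`, then it agrees with it everywhere on `ℝ³`:
the slice `v s` is real-analytic (`analyticOnNhd_slice`), hence so is `curl (v s)` (`analyticOnNhd_curl`), the affine
map is analytic, and `ℝ³` is preconnected. -/
theorem curl_slice_eq_affine_of_eqOn (hrate : HasTypeITimeDecay C v)
    (hcont : ContinuousOn (uncurry v) (Iio (0 : ℝ) ×ˢ univ))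
    (hmild : ∀ s t : ℝ, s < t → t < 0 → ∀ x,
      v t x = UnboundedOperators.heatExtension (v s) (t - s) x - oseenDuhamel 1 s v v t x)
    {s : ℝ} (hs : s < 0) (L : EuclideanSpace ℝ (Fin 3) →L[ℝ] EuclideanSpace ℝ (Fin 3))
    (b : EuclideanSpace ℝ (Fin 3)) {U : Set (EuclideanSpace ℝ (Fin 3))} (hU : IsOpen U) (hne : U.Nonempty)
    (h : ∀ y ∈ U, curl (v s) y = L y + b) : ∀ y, curl (v s) y = L y + b := by
  have hbdd := bdd_of_hasTypeITimeDecay hrate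
  have hω : AnalyticOnNhd ℝ (curl (v s)) univ := analyticOnNhd_curl (analyticOnNhd_slice hcont hbdd hmild hs)
  have hA : AnalyticOnNhd ℝ (fun y => L y + b) univ := fun y _ =>
    (L.analyticAt y).add analyticAt_const
  obtain ⟨y₀, hy₀⟩ := hne
  have hev : curl (v s) =ᶠ[𝓝 y₀] fun y => L y + b := Filter.eventually_of_mem (hU.mem_nhds hy₀) h
  intro y
  exact hω.eqOn_of_preconnected_of_eventuallyEq hA isPreconnected_univ (mem_univ y₀) hev (mem_univ y)

/-- **Affine vorticity with nonzero linear part on an open set of one slice is absurd** in the Type-I class: by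
`curl_slice_eq_affine_of_eqOn` the identity `curl v(s) = L · + b` holds on `ℝ³`; pick `w` with `L w ≠ 0`; then
`‖curl v(s) (n • w)‖ ≥ n ‖L w‖ − ‖b‖` is unbounded in `n`, contradicting the bounded slice vorticity of the class
(`exists_norm_curl_slice_le`). -/
theorem false_of_curl_slice_eqOn_affine (hrate : HasTypeITimeDecay C v)
    (hcont : ContinuousOn (uncurry v) (Iio (0 : ℝ) ×ˢ univ))
    (hmild : ∀ s t : ℝ, s < t → t < 0 → ∀ x,
      v t x = UnboundedOperators.heatExtension (v s) (t - s) x - oseenDuhamel 1 s v v t x)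
    (hdiv : ∀ t < 0, VectorCalculus.IsDivFree (v t))
    {s : ℝ} (hs : s < 0) {L : EuclideanSpace ℝ (Fin 3) →L[ℝ] EuclideanSpace ℝ (Fin 3)} (hL : L ≠ 0)
    (b : EuclideanSpace ℝ (Fin 3)) {U : Set (EuclideanSpace ℝ (Fin 3))} (hU : IsOpen U) (hne : U.Nonempty)
    (h : ∀ y ∈ U, curl (v s) y = L y + b) : False := by
  have hall := curl_slice_eq_affine_of_eqOn hrate hcont hmild hs L b hU hne h
  obtain ⟨K, hK⟩ := exists_norm_curl_slice_le hrate hcont hmild hdiv hs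
  -- a direction along which `L` does not vanish
  obtain ⟨w, hw⟩ : ∃ w, L w ≠ 0 := by
    by_contra hcon
    push Not at hcon
    exact hL (ContinuousLinearMap.ext fun w => by simpa using hcon w)
  have hLw : 0 < ‖L w‖ := norm_pos_iff.2 hw
  -- choose `n` with `n ‖L w‖ > K + ‖b‖`
  obtain ⟨n, hn⟩ := exists_nat_gt ((K + ‖b‖) / ‖L w‖)
  have hn' : K + ‖b‖ < (n : ℝ) * ‖L w‖ := by
    rwa [div_lt_iff₀ hLw] at hn
  have hval : curl (v s) ((n : ℝ) • w) = (n : ℝ) • L w + b := by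
    rw [hall, map_smul]
  have hlow : (n : ℝ) * ‖L w‖ - ‖b‖ ≤ ‖curl (v s) ((n : ℝ) • w)‖ := by
    rw [hval]
    have h1 : ‖(n : ℝ) • L w‖ = (n : ℝ) * ‖L w‖ := by
      rw [norm_smul, Real.norm_natCast]
    -- `‖x‖ - ‖y‖ ≤ ‖x + y‖`
    have h3 : ‖(n : ℝ) • L w‖ - ‖b‖ ≤ ‖(n : ℝ) • L w + b‖ := by
      have h4 : ‖(n : ℝ) • L w‖ ≤ ‖(n : ℝ) • L w + b‖ + ‖b‖ := by
        calc ‖(n : ℝ) • L w‖ = ‖((n : ℝ) • L w + b) - b‖ := by rw [add_sub_cancel_right]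
          _ ≤ ‖(n : ℝ) • L w + b‖ + ‖b‖ := norm_sub_le _ _
      linarith
    rw [h1] at h3
    exact h3
  have hup := hK ((n : ℝ) • w)
  linarith

/-- **Affine vorticity on an open set of one slice ⇒ the profile vanishes identically.** Without any condition on
the linear part: if `L ≠ 0` the configuration is absurd (`false_of_curl_slice_eqOn_affine`); if `L = 0` the slice
vorticity is the constant `b` on all of `ℝ³` (`curl_slice_eq_affine_of_eqOn`), hence invariant under every translation,
and stratum (A) of the tree (`eq_zero_of_curl_translate_eq_slice`, vorticity translation-invariant along a line on
one slice ⇒ `v ≡ 0`) applies. -/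
theorem eq_zero_of_curl_slice_eqOn_affine (hrate : HasTypeITimeDecay C v)
    (hcont : ContinuousOn (uncurry v) (Iio (0 : ℝ) ×ˢ univ))
    (hmild : ∀ s t : ℝ, s < t → t < 0 → ∀ x,
      v t x = UnboundedOperators.heatExtension (v s) (t - s) x - oseenDuhamel 1 s v v t x)
    (hdiv : ∀ t < 0, VectorCalculus.IsDivFree (v t))
    {s : ℝ} (hs : s < 0) (L : EuclideanSpace ℝ (Fin 3) →L[ℝ] EuclideanSpace ℝ (Fin 3))
    (b : EuclideanSpace ℝ (Fin 3)) {U : Set (EuclideanSpace ℝ (Fin 3))} (hU : IsOpen U) (hne : U.Nonempty)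
    (h : ∀ y ∈ U, curl (v s) y = L y + b) : ∀ t < 0, ∀ x, v t x = 0 := by
  by_cases hL : L = 0
  · subst hL
    have hall := curl_slice_eq_affine_of_eqOn hrate hcont hmild hs 0 b hU hne h
    have he : (EuclideanSpace.single 0 1 : EuclideanSpace ℝ (Fin 3)) ≠ 0 := by
      intro h0
      have := congrArg (fun w : EuclideanSpace ℝ (Fin 3) => w 0) h0
      simp at this
    refine eq_zero_of_curl_translate_eq_slice hrate hcont hmild hdiv hs he fun y l => ?_
    rw [hall, hall y, zero_apply, zero_apply]
  · exact (false_of_curl_slice_eqOn_affine hrate hcont hmild hdiv hs hL b hU hne h).elim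

/-- … hence the apex is not a backward singular point. -/
theorem not_backwardSingular_of_curl_slice_eqOn_affine (hrate : HasTypeITimeDecay C v)
    (hcont : ContinuousOn (uncurry v) (Iio (0 : ℝ) ×ˢ univ))
    (hmild : ∀ s t : ℝ, s < t → t < 0 → ∀ x,
      v t x = UnboundedOperators.heatExtension (v s) (t - s) x - oseenDuhamel 1 s v v t x)
    (hdiv : ∀ t < 0, VectorCalculus.IsDivFree (v t))
    {s : ℝ} (hs : s < 0) (L : EuclideanSpace ℝ (Fin 3) →L[ℝ] EuclideanSpace ℝ (Fin 3))
    (b : EuclideanSpace ℝ (Fin 3)) {U : Set (EuclideanSpace ℝ (Fin 3))} (hU : IsOpen U) (hne : U.Nonempty)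
    (h : ∀ y ∈ U, curl (v s) y = L y + b) : ¬ IsBackwardSingularPoint v 0 :=
  not_backwardSingular_of_zero (eq_zero_of_curl_slice_eqOn_affine hrate hcont hmild hdiv hs L b hU hne h)

/-! ### The screw stratum -/

/-- The affine screw field is `y ↦ (k • crossCLM d) y + k • (h • d − d × c)`. -/
theorem screwField_eq_affine (k : ℝ) (c d : EuclideanSpace ℝ (Fin 3)) (h : ℝ) (y : EuclideanSpace ℝ (Fin 3)) :
    k • (cross d (y - c) + h • d) = (k • crossCLM d) y + k • (h • d - cross d c) := by
  rw [_root_.smul_apply, crossCLM_apply, ← smul_add]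
  congr 1
  have hsub : cross d (y - c) = cross d y - cross d c := by
    rw [← crossCLM_apply, ← crossCLM_apply, ← crossCLM_apply, map_sub]
  rw [hsub]
  abel

/-- **The screw-vorticity stratum of the Type-I class is EMPTY**: no profile of the class has, on a nonempty open set
of some slice `s < 0`, vorticity equal to an affine screw field `k • (d × (y − c) + h • d)` with `k ≠ 0`, `d ≠ 0`
(`false_of_curl_slice_eqOn_affine` with `L = k • crossCLM d ≠ 0`). -/
theorem false_of_screwVorticityBall (hrate : HasTypeITimeDecay C v)
    (hcont : ContinuousOn (uncurry v) (Iio (0 : ℝ) ×ˢ univ))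
    (hmild : ∀ s t : ℝ, s < t → t < 0 → ∀ x,
      v t x = UnboundedOperators.heatExtension (v s) (t - s) x - oseenDuhamel 1 s v v t x)
    (hdiv : ∀ t < 0, VectorCalculus.IsDivFree (v t))
    {s : ℝ} (hs : s < 0) {k : ℝ} {c d : EuclideanSpace ℝ (Fin 3)} {h : ℝ} {U : Set (EuclideanSpace ℝ (Fin 3))}
    (hk : k ≠ 0) (hd : d ≠ 0) (hU : IsOpen U) (hne : U.Nonempty)
    (hscrew : ∀ y ∈ U, curl (v s) y = k • (cross d (y - c) + h • d)) : False := by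
  have hL : k • crossCLM d ≠ 0 := smul_ne_zero hk (crossCLM_ne_zero hd)
  refine false_of_curl_slice_eqOn_affine hrate hcont hmild hdiv hs hL (k • (h • d - cross d c)) hU hne ?_
  intro y hy
  rw [hscrew y hy, screwField_eq_affine]

/-- **Screw (or degenerate-screw) vorticity on an open set of one slice ⇒ the profile vanishes identically**, for
ANY amplitude `k`, axis `d`, centre `c`, pitch `h` (no non-degeneracy needed: the screw field is affine,
`eq_zero_of_curl_slice_eqOn_affine`). -/
theorem eq_zero_of_screwVorticityBall (hrate : HasTypeITimeDecay C v)
    (hcont : ContinuousOn (uncurry v) (Iio (0 : ℝ) ×ˢ univ))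
    (hmild : ∀ s t : ℝ, s < t → t < 0 → ∀ x,
      v t x = UnboundedOperators.heatExtension (v s) (t - s) x - oseenDuhamel 1 s v v t x)
    (hdiv : ∀ t < 0, VectorCalculus.IsDivFree (v t))
    {s : ℝ} (hs : s < 0) (k : ℝ) (c d : EuclideanSpace ℝ (Fin 3)) (h : ℝ) {U : Set (EuclideanSpace ℝ (Fin 3))}
    (hU : IsOpen U) (hne : U.Nonempty)
    (hscrew : ∀ y ∈ U, curl (v s) y = k • (cross d (y - c) + h • d)) : ∀ t < 0, ∀ x, v t x = 0 := by
  refine eq_zero_of_curl_slice_eqOn_affine hrate hcont hmild hdiv hs (k • crossCLM d) (k • (h • d - cross d c))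
    hU hne ?_
  intro y hy
  rw [hscrew y hy, screwField_eq_affine]

/-- **Stub 2 `stub_screwSliceRigidity : ScrewSliceRigidity` of the K2⁗ birth skeleton, with `FrobeniusClass` and
`HasScrewVorticityBall` unfolded verbatim** (route-helicity `bc/FrobeniusProfileRigidity_birth.lean`, nsreg-p1 g11):
a helicity-free profile of the Type-I class whose vorticity is an affine screw field on a ball of some slice is not
backward-singular at the apex — indeed no such profile exists (`false_of_screwVorticityBall`); neither the helicity
conjunct of the class nor the non-degeneracy conditions `k ≠ 0`, `d ≠ 0` are used (`eq_zero_of_screwVorticityBall`). -/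
theorem screwSliceRigidity
    (hcls : Literature.Analysis.FluidPDE.HasTypeITimeDecay C v ∧
      ContinuousOn (Function.uncurry v) (Set.Iio (0 : ℝ) ×ˢ Set.univ) ∧
      (∀ s t : ℝ, s < t → t < 0 → ∀ x, v t x =
        Literature.Analysis.UnboundedOperators.heatExtension (v s) (t - s) x -
          Literature.Analysis.FluidPDE.oseenDuhamel 1 s v v t x) ∧
      (∀ t < 0, Literature.Analysis.FluidPDE.VectorCalculus.IsDivFree (v t)) ∧
      (∀ s < 0, ∀ y : EuclideanSpace ℝ (Fin 3),
        inner ℝ (v s y) (Literature.Analysis.FluidPDE.curl (v s) y) = 0))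
    (hscrew : ∃ s < 0, ∃ (k : ℝ) (c d : EuclideanSpace ℝ (Fin 3)) (h : ℝ) (U : Set (EuclideanSpace ℝ (Fin 3))),
      k ≠ 0 ∧ d ≠ 0 ∧ IsOpen U ∧ U.Nonempty ∧
      ∀ y ∈ U, Literature.Analysis.FluidPDE.curl (v s) y =
        k • (Literature.Analysis.FluidPDE.cross d (y - c) + h • d)) :
    ¬ Literature.Analysis.FluidPDE.IsBackwardSingularPoint v 0 := by
  obtain ⟨hrate, hcont, hmild, hdiv, -⟩ := hcls
  obtain ⟨s, hs, k, c, d, h, U, -, -, hU, hne, hsc⟩ := hscrew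
  exact not_backwardSingular_of_zero (eq_zero_of_screwVorticityBall hrate hcont hmild hdiv hs k c d h hU hne hsc)

end Summit.NavierStokesRegularity.NavierStokesRegularity.Theorems.LocalHelicityTubeDoorFrobeniusProfileRigidityScrewSlice

end
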